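/-
Copyright (c) 2026. All rights reserved.
Released under Apache 2.0 license as described in the file LICENSE.
Authors: abc-iut cell, wave-4 seat abc-iut-w4-d059 (proof-only; sub-DAG [SemiAnbd] Thm 5.4 row T54-3c: clause 2
of Thm 5.4 (i) and the assembly of `ArithMaximalCompactStatementI` over level data).
-/
import Literature.AnabelianGeometry.SemiGraphs.ArithMaximalCompact
import Literature.AnabelianGeometry.SemiGraphs.TreeSystemHstar
import HarnessLib

/-!
# [SemiAnbd] Thm 5.4 (i), clause 2 («precisely two verticial subgroups, whose intersection is edge-like»)
# and the assembly of (i) over arithmetic level data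

Mochizuki, *Semi-graphs of anabelioids*, Publ. RIMS **42** (2006), §5, Theorem 5.4 (i) p. 66 of the author's
manuscript [cite: MochizukiSemiAnbd2006, Thm 5.4 (i), p. 66]: "Every arithmetically ample compact subgroup
of `π₁^temp(𝔊)` is contained in at least one verticial subgroup. If [it] is contained in more than one
verticial subgroup, then it is contained in precisely two verticial subgroups, whose intersection forms an
edge-like subgroup" — typed by abc-iut-L3-t3 as the predicate `ArithMaximalCompactStatementI D aug` on the
data of p. 65 (`ArithMaximalCompact.lean`). Printed proof: "entirely parallel to the proofs of Theorem 3.7,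
Corollary 3.9" (p. 66), i.e. the tree argument of Thm 3.7 (iii) p. 41 with the author's Comments (6) (May
2020: condition (∗_j), "(c) … if `H` is contained in three distinct verticial subgroups … contradiction").

PROOF-ONLY (no definition), over LOOSE BINDERS (sub-DAG T54 ruling R2/R9): a directed system of trees
`T j` ("`𝒢_{∞,j}`") acted on by `Π^temp_𝔊 = Gtp` through `ρ j`, with `Gtp`-equivariant transition morphisms
`f`, WITHOUT branch switching (`hnoswap` — print's hypothesis "the arithmetic actions on the underlying
graphs … do not switch the branches of any edge", Thm 5.4), and the two-sided arithmetic DICTIONARY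
(producer's obligations, row T54-0; print p. 65 "the decomposition group `Π^temp_{𝔊,v}`, `Π^temp_{𝔊,b}`
[well-defined up to conjugation]" = stabilisers in `Π^temp_𝔊` of lifts to the pro-tree):
`hfix` — a verticial subgroup IS the pointwise stabiliser of some compatible system of tree vertices;
`hedge` — the pointwise stabiliser of an (eventual) compatible system of tree edges with their branches IS an
edge-like subgroup. Then:

* `arith_conj2_of_hstar` — CLAUSE 2 of Thm 5.4 (i) for a subgroup `C` satisfying (∗_j) ("for every `j`
  there is `i ≥ j` such that all `C`-fixed edges of `T i` have one image in `T j`"; for arithmetically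
  ample compact `C` this is the arithmetic estrangement step, row T54-3a `hstar_of_isArithAmple`,
  abc-iut-w4-d029): if `C ≤ W₁`, `C ≤ W₂` for distinct verticial `W₁`, `W₂`, then every verticial `W₃ ≥ C`
  is `W₁` or `W₂` (abc-iut-L3-t11's `SemiGraph.atMostTwo_systems_of_hstar`), and `W₁ ⊓ W₂` is the
  stabiliser of the compatible system of tree edges joining the two fixed vertex systems
  (`SemiGraph.adjacent_of_hstar`, `edge_unique_of_abuts`), hence EDGE-LIKE;
* `arithMaximalCompactStatementI_of_levelData` — the ASSEMBLY of `ArithMaximalCompactStatementI D aug`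
  from clause 1 (row T54-3b, hypothesis `hconj1` in that row's exact signature) and (∗_j) for every
  arithmetically ample compact subgroup (row T54-3a, hypothesis `hstar`).

Only the GENERIC tree-system lemmas of `TreeSystemHstar` / `TreeSystemFixedPair` are used: no statement of
Thm 3.7 is consumed. Nothing here asserts a hypothesis of Thm 5.4 for any data, and nothing bears on
[IUTchIII] Cor. 3.12.
-/

namespace Literature.AnabelianGeometry.SemiGraphs

open CategoryTheory Topology

universe v u u' w w'

variable {Gtp : Type u} [Group Gtp] [TopologicalSpace Gtp]
variable {PA : Type u'} [Group PA] [TopologicalSpace PA]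
variable {V : Type w} {B : Type w'}
variable (D : DecompositionData Gtp V B) (aug : Gtp →* PA)
variable {J : Type v} [Preorder J] [IsDirectedOrder J]
  (T : J → SemiGraph.{u}) (ρ : ∀ j, Gtp →* Aut (T j)) (f : ∀ ⦃i j : J⦄, i ≤ j → (T j ⟶ T i))

/-! ### An automorphism fixing two adjacent vertices fixes the edge between them (with its branches) -/

omit [TopologicalSpace Gtp] [Preorder J] [IsDirectedOrder J] in
/-- In a tree, an automorphism without branch switching that fixes the two (distinct) end-vertices of an edge
fixes the edge and all its branches. [cite: MochizukiSemiAnbd2006, Thm. 3.7(iii) p.41] -/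
theorem edge_fixed_of_ends_fixed (hT : ∀ j, (T j).IsTree) (j : J)
    (hnoswap : ∀ (g : Gtp) (b : (T j).Branch),
      (ρ j g).hom.edgeMap ((T j).edgeOf b) = (T j).edgeOf b → (ρ j g).hom.branchMap b = b)
    {a a' : (T j).Vertex} (haa : a ≠ a') {e : (T j).Edge} {c c' : (T j).Branch}
    (hce : (T j).edgeOf c = e) (hc'e : (T j).edgeOf c' = e) (hca : (T j).abuts c = some a)
    (hc'a : (T j).abuts c' = some a') (g : Gtp) (hga : (ρ j g).hom.vertexMap a = a)
    (hga' : (ρ j g).hom.vertexMap a' = a') :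
    (ρ j g).hom.edgeMap e = e ∧ ∀ b : (T j).Branch, (T j).edgeOf b = e → (ρ j g).hom.branchMap b = b := by
  have he : (ρ j g).hom.edgeMap e = e := by
    refine (SemiGraph.edge_unique_of_abuts (hT j) haa (c := (ρ j g).hom.branchMap c)
      (d := (ρ j g).hom.branchMap c') (c' := c) (d' := c') ?_ ?_ hce hc'e ?_ ?_ hca hc'a)
    · rw [(ρ j g).hom.edgeOf_branchMap, hce]
    · rw [(ρ j g).hom.edgeOf_branchMap, hc'e]
    · rw [(ρ j g).hom.abuts_branchMap c a hca, hga]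
    · rw [(ρ j g).hom.abuts_branchMap c' a' hc'a, hga']
  exact ⟨he, fun b hb => hnoswap g b (by rw [hb]; exact he)⟩

/-! ### Clause 2 of Theorem 5.4 (i) under (∗_j) -/

omit [TopologicalSpace Gtp] in
/-- **[SemiAnbd] Thm 5.4 (i), clause 2, under (∗_j)** ("parallel to Theorem 3.7 (iii)", Comments (6)(b),(c)):
let `C ≤ Π^temp_𝔊` satisfy (∗_j) (`hstar`) and lie in two distinct verticial subgroups `W₁`, `W₂`. Then
(a) every verticial subgroup containing `C` is `W₁` or `W₂` — the three fixed vertex systems would be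
pairwise different somewhere, contradicting `SemiGraph.atMostTwo_systems_of_hstar`; (b) `W₁ ⊓ W₂` is
EDGE-LIKE — the fixed systems `x₁ ≠ x₂` of `W₁`, `W₂` are joined, from some level on, by a unique edge fixed
with its branches (`SemiGraph.adjacent_of_hstar`); these edges form a compatible system whose stabiliser
`L` is edge-like (`hedge`) and equals `W₁ ⊓ W₂` (an element of `W₁ ⊓ W₂` fixes both ends, hence the edge;
an element of `L` fixes the branches, hence both ends, hence both systems by compatibility).
Dictionary binders `hfix`, `hedge` two-sided (ruling R7); `hnoswap` = "no branch switching".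
[cite: MochizukiSemiAnbd2006, Thm 5.4 (i), p. 66] -/
theorem arith_conj2_of_hstar (hT : ∀ j, (T j).IsTree)
    (hequiv : ∀ ⦃i j : J⦄ (h : i ≤ j) (g : Gtp) (x : (T j).Vertex),
      (f h).vertexMap ((ρ j g).hom.vertexMap x) = (ρ i g).hom.vertexMap ((f h).vertexMap x))
    (hnoswap : ∀ (j : J) (g : Gtp) (b : (T j).Branch),
      (ρ j g).hom.edgeMap ((T j).edgeOf b) = (T j).edgeOf b → (ρ j g).hom.branchMap b = b)
    (hfix : ∀ W : Subgroup Gtp, IsVerticial D W → ∃ x : ∀ j, (T j).Vertex,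
      (∀ ⦃i j : J⦄ (h : i ≤ j), (f h).vertexMap (x j) = x i) ∧
        ∀ g : Gtp, g ∈ W ↔ ∀ j, (ρ j g).hom.vertexMap (x j) = x j)
    (hedge : ∀ (j₁ : J) (ε : ∀ j : {j : J // j₁ ≤ j}, (T j.1).Edge),
      (∀ ⦃i j : {j : J // j₁ ≤ j}⦄ (h : i.1 ≤ j.1), (f h).edgeMap (ε j) = ε i) →
      ∃ L : Subgroup Gtp, IsEdgeLike D L ∧
        ∀ g : Gtp, g ∈ L ↔ ∀ j, (ρ j.1 g).hom.edgeMap (ε j) = ε j ∧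
          ∀ b : (T j.1).Branch, (T j.1).edgeOf b = ε j → (ρ j.1 g).hom.branchMap b = b)
    (C : Subgroup Gtp)
    (hstar : ∀ j : J, ∃ (i : J) (h : j ≤ i), ∀ e e' : (T i).Edge,
      (∀ γ : C, (ρ i γ).hom.edgeMap e = e) → (∀ γ : C, (ρ i γ).hom.edgeMap e' = e') →
      (f h).edgeMap e = (f h).edgeMap e')
    {W₁ W₂ : Subgroup Gtp} (hW₁ : IsVerticial D W₁) (hW₂ : IsVerticial D W₂) (hne : W₁ ≠ W₂)
    (hC₁ : C ≤ W₁) (hC₂ : C ≤ W₂) :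
    (∀ W₃ : Subgroup Gtp, IsVerticial D W₃ → C ≤ W₃ → W₃ = W₁ ∨ W₃ = W₂) ∧ IsEdgeLike D (W₁ ⊓ W₂) := by
  classical
  -- the restricted actions of `C`
  let ρC : ∀ j, C →* Aut (T j) := fun j => (ρ j).comp C.subtype
  have hstarC : ∀ j : J, ∃ (i : J) (h : j ≤ i), ∀ e e' : (T i).Edge,
      (∀ γ : C, (ρC i γ).hom.edgeMap e = e) → (∀ γ : C, (ρC i γ).hom.edgeMap e' = e') →
      (f h).edgeMap e = (f h).edgeMap e' := hstar
  -- the fixed systems `x₁`, `x₂` of `W₁`, `W₂`; `C` fixes both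
  obtain ⟨x₁, hx₁c, hx₁W⟩ := hfix W₁ hW₁
  obtain ⟨x₂, hx₂c, hx₂W⟩ := hfix W₂ hW₂
  have hx₁C : ∀ (j : J) (γ : C), (ρC j γ).hom.vertexMap (x₁ j) = x₁ j :=
    fun j γ => (hx₁W γ).mp (hC₁ γ.2) j
  have hx₂C : ∀ (j : J) (γ : C), (ρC j γ).hom.vertexMap (x₂ j) = x₂ j :=
    fun j γ => (hx₂W γ).mp (hC₂ γ.2) j
  -- two verticial subgroups with the same fixed system coincide
  have eq_of_systems : ∀ {W W' : Subgroup Gtp} {x x' : ∀ j, (T j).Vertex},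
      (∀ g : Gtp, g ∈ W ↔ ∀ j, (ρ j g).hom.vertexMap (x j) = x j) →
      (∀ g : Gtp, g ∈ W' ↔ ∀ j, (ρ j g).hom.vertexMap (x' j) = x' j) → x = x' → W = W' := by
    intro W W' x x' hW hW' hxx
    subst hxx
    ext g
    rw [hW g, hW' g]
  -- hence `x₁ ≠ x₂` at some level `i`
  have hx₁₂ : ∃ i, x₁ i ≠ x₂ i := by
    by_contra hall
    push Not at hall
    exact hne (eq_of_systems hx₁W hx₂W (funext hall))
  obtain ⟨i, hi⟩ := hx₁₂
  refine ⟨fun W₃ hW₃ hC₃ => ?_, ?_⟩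
  · -- ONLY TWO
    obtain ⟨x₃, hx₃c, hx₃W⟩ := hfix W₃ hW₃
    have hx₃C : ∀ (j : J) (γ : C), (ρC j γ).hom.vertexMap (x₃ j) = x₃ j :=
      fun j γ => (hx₃W γ).mp (hC₃ γ.2) j
    by_cases h31 : ∃ i₁, x₃ i₁ ≠ x₁ i₁
    · by_cases h32 : ∃ i₂, x₃ i₂ ≠ x₂ i₂
      · obtain ⟨i₁, hi₁⟩ := h31
        obtain ⟨i₂, hi₂⟩ := h32
        exact (SemiGraph.atMostTwo_systems_of_hstar T ρC f hT hstarC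
          hx₃c hx₁c hx₂c hx₃C hx₁C hx₂C hi₁ hi hi₂).elim
      · push Not at h32
        exact Or.inr (eq_of_systems hx₃W hx₂W (funext h32))
    · push Not at h31
      exact Or.inl (eq_of_systems hx₃W hx₁W (funext h31))
  · -- THE EDGE between the two fixed systems, from level `i` on
    have adj : ∀ j : {j : J // i ≤ j}, ∃ (e : (T j.1).Edge) (b b' : (T j.1).Branch),
        (T j.1).IsClosedEdge e ∧ b ≠ b' ∧ (T j.1).edgeOf b = e ∧ (T j.1).edgeOf b' = e ∧
        (T j.1).abuts b = some (x₁ j.1) ∧ (T j.1).abuts b' = some (x₂ j.1) ∧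
        ∀ γ : C, (ρC j.1 γ).hom.edgeMap e = e ∧
          ∀ b'' : (T j.1).Branch, (T j.1).edgeOf b'' = e → (ρC j.1 γ).hom.branchMap b'' = b'' :=
      fun j => SemiGraph.adjacent_of_hstar T ρC f hT hstarC hx₁c hx₂c hx₁C hx₂C hi j.2
    choose ε bε bε' hεcl hbb hbε hb'ε hbx hb'x hεfix using adj
    have hx12 : ∀ j : {j : J // i ≤ j}, x₁ j.1 ≠ x₂ j.1 := fun j =>
      SemiGraph.ne_of_compatible_ne T (fun i j h => (f h).vertexMap) hx₁c hx₂c hi j.2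
    -- compatibility of the edges (uniqueness of the edge joining `x₁ j` and `x₂ j`)
    have hεc : ∀ ⦃i' j : {j : J // i ≤ j}⦄ (h : i'.1 ≤ j.1), (f h).edgeMap (ε j) = ε i' := by
      intro i' j h
      refine SemiGraph.edge_unique_of_abuts (hT i'.1) (hx12 i') (c := (f h).branchMap (bε j))
        (d := (f h).branchMap (bε' j)) (c' := bε i') (d' := bε' i') ?_ ?_ (hbε i') (hb'ε i') ?_ ?_
        (hbx i') (hb'x i')
      · rw [(f h).edgeOf_branchMap, hbε j]
      · rw [(f h).edgeOf_branchMap, hb'ε j]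
      · rw [(f h).abuts_branchMap _ _ (hbx j), hx₁c h]
      · rw [(f h).abuts_branchMap _ _ (hb'x j), hx₂c h]
    -- the dictionary: the stabiliser of the edge system is an edge-like `L`
    obtain ⟨L, hL, hLiff⟩ := hedge i ε hεc
    -- `W₁ ⊓ W₂ = L`
    suffices hWL : W₁ ⊓ W₂ = L by rw [hWL]; exact hL
    ext g
    rw [Subgroup.mem_inf, hx₁W g, hx₂W g, hLiff g]
    constructor
    · rintro ⟨hg₁, hg₂⟩ j
      exact edge_fixed_of_ends_fixed T ρ hT j.1 (hnoswap j.1) (hx12 j) (hbε j) (hb'ε j) (hbx j) (hb'x j) g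
        (hg₁ j.1) (hg₂ j.1)
    · intro hg
      -- `g` fixes the branches of `ε j`, hence both end-vertices, for `j ≥ i`; then everywhere by compatibility
      have hends : ∀ j : {j : J // i ≤ j},
          (ρ j.1 g).hom.vertexMap (x₁ j.1) = x₁ j.1 ∧ (ρ j.1 g).hom.vertexMap (x₂ j.1) = x₂ j.1 := by
        intro j
        obtain ⟨-, hbr⟩ := hg j
        have h1 := (ρ j.1 g).hom.abuts_branchMap (bε j) (x₁ j.1) (hbx j)
        have h2 := (ρ j.1 g).hom.abuts_branchMap (bε' j) (x₂ j.1) (hb'x j)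
        rw [hbr (bε j) (hbε j), hbx j] at h1
        rw [hbr (bε' j) (hb'ε j), hb'x j] at h2
        exact ⟨(Option.some.inj h1).symm, (Option.some.inj h2).symm⟩
      have hall : ∀ j : J, (ρ j g).hom.vertexMap (x₁ j) = x₁ j ∧ (ρ j g).hom.vertexMap (x₂ j) = x₂ j := by
        intro j
        obtain ⟨k, hik, hjk⟩ := exists_ge_ge i j
        obtain ⟨h1, h2⟩ := hends ⟨k, hik⟩
        constructor
        · rw [← hx₁c hjk, ← hequiv hjk g (x₁ k), h1]
        · rw [← hx₂c hjk, ← hequiv hjk g (x₂ k), h2]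
      exact ⟨fun j => (hall j).1, fun j => (hall j).2⟩

/-! ### The assembly of Theorem 5.4 (i) -/

/-- **[SemiAnbd] Thm 5.4 (i) — `ArithMaximalCompactStatementI D aug` ASSEMBLED over arithmetic level
data**, from: clause 1 (`hconj1`: every arithmetically ample compact subgroup lies in a verticial subgroup —
row T54-3b, the twin of the first part of Thm 3.7 (iii)); the condition (∗_j) for every arithmetically ample
compact subgroup (`hstar` — row T54-3a, total arithmetic estrangement); and the tree system with the two-sided
dictionary (`hfix`, `hedge`), equivariance and no branch switching, through `arith_conj2_of_hstar`.
[cite: MochizukiSemiAnbd2006, Thm 5.4 (i), p. 66] -/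
theorem arithMaximalCompactStatementI_of_levelData (hT : ∀ j, (T j).IsTree)
    (hequiv : ∀ ⦃i j : J⦄ (h : i ≤ j) (g : Gtp) (x : (T j).Vertex),
      (f h).vertexMap ((ρ j g).hom.vertexMap x) = (ρ i g).hom.vertexMap ((f h).vertexMap x))
    (hnoswap : ∀ (j : J) (g : Gtp) (b : (T j).Branch),
      (ρ j g).hom.edgeMap ((T j).edgeOf b) = (T j).edgeOf b → (ρ j g).hom.branchMap b = b)
    (hfix : ∀ W : Subgroup Gtp, IsVerticial D W → ∃ x : ∀ j, (T j).Vertex,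
      (∀ ⦃i j : J⦄ (h : i ≤ j), (f h).vertexMap (x j) = x i) ∧
        ∀ g : Gtp, g ∈ W ↔ ∀ j, (ρ j g).hom.vertexMap (x j) = x j)
    (hedge : ∀ (j₁ : J) (ε : ∀ j : {j : J // j₁ ≤ j}, (T j.1).Edge),
      (∀ ⦃i j : {j : J // j₁ ≤ j}⦄ (h : i.1 ≤ j.1), (f h).edgeMap (ε j) = ε i) →
      ∃ L : Subgroup Gtp, IsEdgeLike D L ∧
        ∀ g : Gtp, g ∈ L ↔ ∀ j, (ρ j.1 g).hom.edgeMap (ε j) = ε j ∧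
          ∀ b : (T j.1).Branch, (T j.1).edgeOf b = ε j → (ρ j.1 g).hom.branchMap b = b)
    (hconj1 : ∀ C : Subgroup Gtp, IsCompact (C : Set Gtp) → IsArithAmple aug C →
      ∃ W : Subgroup Gtp, IsVerticial D W ∧ C ≤ W)
    (hstar : ∀ C : Subgroup Gtp, IsCompact (C : Set Gtp) → IsArithAmple aug C →
      ∀ j : J, ∃ (i : J) (h : j ≤ i), ∀ e e' : (T i).Edge,
        (∀ γ : C, (ρ i γ).hom.edgeMap e = e) → (∀ γ : C, (ρ i γ).hom.edgeMap e' = e') →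
        (f h).edgeMap e = (f h).edgeMap e') :
    Literature.AnabelianGeometry.SemiGraphs.ArithMaximalCompactStatementI D aug := by
  intro K hK hKamp
  refine ⟨hconj1 K hK hKamp, fun W₁ W₂ hW₁ hW₂ hne h₁ h₂ => ?_⟩
  exact arith_conj2_of_hstar D T ρ f hT hequiv hnoswap hfix hedge K (hstar K hK hKamp) hW₁ hW₂ hne h₁ h₂

end Literature.AnabelianGeometry.SemiGraphs
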